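import Literature.NumberTheory.Transcendental.ConjugateRechartHodgeTypes
import Literature.AlgebraicGeometry.Motives.ConjugatePointsHomeomorph
import Literature.AlgebraicGeometry.Motives.FiberBaseChange
import Literature.AlgebraicGeometry.Motives.CurveNet
import Literature.AlgebraicGeometry.HodgeTheory.HodgeTypeConjugateEmbedding
import Literature.AlgebraicGeometry.HodgeTheory.HodgeFiltrationModelsReductionProofs
import Literature.AlgebraicGeometry.HodgeTheory.HodgeTypePullback
import Literature.AlgebraicGeometry.HodgeTheory.RationalHodgeClassesNonempty
import HarnessLib

/-!
# Hodge types are reversed under complex conjugation of the structure embedding (discharge of `ConjEmbedding.isOfHodgeType_conj_iff`)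

Family `hodge`, layer `Literature/AlgebraicGeometry/HodgeTheory`; cell hodgecm-mathlib, floor 0, kernel K-A1.  Theorems-only leaf companion
of `HodgeTypeConjugateEmbedding` (the named fact `ConjEmbedding.isOfHodgeType_conj_iff`, [Deligne1979Valeurs] 0.2.5: for an `L`-scheme
`Y` and `ι : L →+* ℂ` with both `Y ×_{L,ι} ℂ` and `Y ×_{L,ῑ} ℂ` smooth projective of dimension `n`, a class `c ∈ Hᵏ((Y ×_ι ℂ)(ℂ); ℂ)` is of
Hodge type `(p,q)` iff its transport `complexBettiConj ι Y k c` along complex conjugation of points is of Hodge type `(q,p)`).  PROVED here: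

* `exists_conjugate_hodgeModel` — **the conjugate Hodge model**: from a Hodge model `A` of a `ℂ`-scheme `X` (analytification
  `M → X(ℂ)` charted on `E`, natural de Rham comparison, Hodge decomposition — `HodgeTheory.HodgeModel`) a Hodge model `Ā` of the
  CONJUGATE VARIETY `X^σ = X ×_{ℂ,σ} ℂ` (`Motives.conjugateVariety`, `σ` = complex conjugation): the conjugate complex manifold
  `M̄ = Rechart L M` of `Transcendental/ConjugateRechart` (`L` antilinear; holomorphic atlas `Rechart.isManifold_complex_of_antilinear`) mapped
  to `X^σ(ℂ)` by `toConjugate ∘ (M → X(ℂ)) ∘ out` — an analytification, since a regular function of `X^σ` evaluates at `toConjugate P` to the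
  conjugate of a regular function of `X` at `P` (`Motives.AlgPoints.evalOrZero_toConjugate`, Charles–Schnell §11.2.2) and conjugates of
  holomorphic functions are holomorphic on `M̄` (`mdifferentiableOn_conj_comp_out`) — with the SAME de Rham comparison family and the transported
  Hodge decomposition (`isInternal_hodgePQ_rechart`); and `c` has type `(p,q)` in `A` iff `(toConjugate⁻¹)^* c` has type `(q,p)` in `Ā`
  (`hodgePQ_map_out_eq`: `out^* H^{p,q}(M) = H^{q,p}(M̄)`, naturality of `A.deRham` along `out`);
* `map_iso_inv_conjComplexPoints`, `ofConjugate_map_iso_inv` — the transitivity isomorphism `(Y ×_ι ℂ)^σ ≅ Y ×_{σ∘ι} ℂ`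
  (`Motives.baseChangeHomObjIsoOfComp`) carries `ConjEmbedding.conjComplexPoints` to `AlgPoints.toConjugate`;
* `isOfHodgeType_conj_iff_holds` — **discharge of the named fact**, from the two items, independence of Hodge types from the model
  (`hodgePQ_independent_of_hodgeModel_holds`), existence of Hodge models (`HodgeModel_nonempty`) and transport of Hodge types along
  isomorphisms (`IsOfHodgeType.map_of_le`).

No definition, no named fact, no `sorry` (net Literature debt −1: the fact of `HodgeTypeConjugateEmbedding` is retired).  HC_CM (cell
hodgecm-mathlib) is proved only modulo its printed citations until rung 0 closes; this file discharges the floor-0 debt (A1) only.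

## References
* [Deligne1979Valeurs] P. Deligne, *Valeurs de fonctions L et périodes d'intégrales*, Proc. Symp. Pure Math. 33.2 (1979), 0.2.5 (p. 315).
* [Deligne1982HodgeCycles] P. Deligne, *Hodge cycles on abelian varieties*, LNM 900 (1982), §1 (p. 7).
* [VoisinHodgeI2002] C. Voisin, *Hodge Theory and Complex Algebraic Geometry I*, CUP 2002, §6.1.2–6.1.3, §7.3.2.
* [CharlesSchnell2014Notes] F. Charles, C. Schnell, *Notes on absolute Hodge classes* (2014), §11.2.2 (11.2.1).
* [SerreGAGA1956] J.-P. Serre, GAGA, Ann. Inst. Fourier 6 (1956), §2.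
-/

noncomputable section

open scoped Manifold ContDiff Topology ComplexConjugate

namespace Literature.AlgebraicGeometry.HodgeTheory.ConjEmbedding

open Literature.AlgebraicGeometry.Motives Literature.AlgebraicTopology.SingularHomology
open Literature.NumberTheory.Transcendental Literature.Geometry.Manifold CategoryTheory

/-! ## The conjugate Hodge model of the conjugate variety -/


/-- **The conjugate Hodge model.** From a Hodge model `A` of the `ℂ`-scheme `X` (analytification `M = A.carrier → X(ℂ)` charted on
`E = A.model`, natural de Rham comparison, Hodge decomposition) one obtains a Hodge model `Ā` of the CONJUGATE variety
`X^σ = X ×_{ℂ,σ} ℂ`, `σ` = complex conjugation: the conjugate complex manifold `M̄ = Rechart L M` (`L` antilinear) mapped to `X^σ(ℂ)` by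
`toConjugate ∘ (M → X(ℂ)) ∘ out` (regular functions of `X^σ` pull back to conjugates of holomorphic functions,
`AlgPoints.evalOrZero_toConjugate`, holomorphic on `M̄`), with the SAME de Rham comparison family and the transported Hodge decomposition;
and under the antiholomorphic identification a class `c` has type `(p,q)` for `A` iff its conjugation transport has type `(q,p)` for `Ā`
([Deligne1982HodgeCycles] §1 p. 7: «as `ι` defines a homeomorphism `σX^{an} → ισX^{an}`, it induces an isomorphism `H_{ισ}(X) ≅ H_σ(X)`»;
[VoisinHodgeI2002] §6.1.2: `H^{p,q}(X̄) = H^{q,p}(X)`). [cite: Deligne1982HodgeCycles, §1 (p. 7)] [cite: VoisinHodgeI2002, §6.1.2–6.1.3] -/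
theorem exists_conjugate_hodgeModel {n : ℕ} {X : SchemeOver ℂ} (A : HodgeModel n X) (σ : ℂ ≃+* ℂ)
    (hσ : Continuous σ) (hσc : ∀ z, σ z = conj z) :
    ∃ B : HodgeModel n (conjugateVariety σ X),
      ∀ (k p q : ℕ) (c : singularCohomology ℂ ℂ (ComplexPoints X) k),
        A.pullback k c ∈ A.hodgePQ k p q ↔
          B.pullback k (singularCohomology.map ℂ ℂ
              ((AlgPoints.conjugateHomeomorph σ X hσ).symm : C(ComplexPoints (conjugateVariety σ X), ComplexPoints X)) k c) ∈
            B.hodgePQ k q p := by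
  obtain ⟨L, hL⟩ := exists_antilinear (E := A.model)
  haveI : CompleteSpace A.model := FiniteDimensional.complete ℂ A.model
  haveI hR : IsManifold 𝓘(ℝ, A.model) ∞ (Rechart L.toHomeomorph A.carrier) := Rechart.isManifold_real_of_linear L
  haveI hC : IsManifold 𝓘(ℂ, A.model) ω (Rechart L.toHomeomorph A.carrier) := Rechart.isManifold_complex_of_antilinear L hL
  -- the comparison map `M̄ → X^σ(ℂ)`
  let φ : Rechart L.toHomeomorph A.carrier → ComplexPoints (conjugateVariety σ X) := fun m ↦
    AlgPoints.toConjugate σ X (A.toComplexPoints (Rechart.out L.toHomeomorph A.carrier m))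
  have hφ : IsAnalytification A.model (conjugateVariety σ X) n φ :=
    { isHomeomorph := (AlgPoints.conjugateHomeomorph σ X hσ).isHomeomorph.comp
        (A.isAnalytification.isHomeomorph.comp (Rechart.outHomeomorph L.toHomeomorph A.carrier).isHomeomorph)
      finrank_eq := A.isAnalytification.finrank_eq
      mdifferentiableOn_evalOrZero := fun U' s' ↦ by
        have hfun : (fun m ↦ AlgPoints.evalOrZero (↑U' : (conjugateVariety σ X).left.Opens) s' (φ m)) =
            starRingEnd ℂ ∘ (fun m' ↦ AlgPoints.evalOrZero (AlgPoints.invPreimage σ X ↑U')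
              ((inv (AlgPoints.conjFst σ X)).app ↑U' s') (A.toComplexPoints m')) ∘ Rechart.out L.toHomeomorph A.carrier := by
          funext m
          rw [Function.comp_apply, Function.comp_apply, ← hσc]
          exact AlgPoints.evalOrZero_toConjugate (σ := σ) (Y := X) (↑U') s' _
        have hset : φ ⁻¹' {P | P.pt ∈ (↑U' : (conjugateVariety σ X).left.Opens)} =
            Rechart.out L.toHomeomorph A.carrier ⁻¹'
              (A.toComplexPoints ⁻¹' {P | P.pt ∈ AlgPoints.invPreimage σ X ↑U'}) := by
          ext m
          exact AlgPoints.pt_toConjugate_mem_iff' (σ := σ) _ _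
        rw [hfun, hset]
        exact mdifferentiableOn_conj_comp_out L hL
          (A.isAnalytification.mdifferentiableOn_evalOrZero ⟨_, AlgPoints.isAffineOpen_invPreimage U'.2⟩ _) }
  let B : HodgeModel n (conjugateVariety σ X) :=
    { model := A.model
      carrier := Rechart L.toHomeomorph A.carrier
      toComplexPoints := φ
      isAnalytification := hφ
      deRham := A.deRham
      deRham_isNatural := A.deRham_isNatural
      isInternal_hodgePQ := fun k ↦ isInternal_hodgePQ_rechart L hL (A.isInternal_hodgePQ k) }
  refine ⟨B, fun k p q c ↦ ?_⟩
  -- `out^*` on singular cohomology, an injective map (out is a homeomorphism)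
  let outC : C(Rechart L.toHomeomorph A.carrier, A.carrier) :=
    ⟨Rechart.out L.toHomeomorph A.carrier, (Rechart.contMDiff_out_linear (M := A.carrier) L).continuous⟩
  have hinj : Function.Injective (singularCohomology.map ℂ ℂ outC k).hom := by
    have e : outC = ((Rechart.outHomeomorph L.toHomeomorph A.carrier : Rechart L.toHomeomorph A.carrier ≃ₜ A.carrier) :
        C(Rechart L.toHomeomorph A.carrier, A.carrier)) := rfl
    rw [e, ← singularCohomology.mapIso_hom]
    exact (singularCohomology.mapIso ℂ ℂ (Rechart.outHomeomorph L.toHomeomorph A.carrier) k).toLinearEquiv.injective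
  -- Step 1: `B.pullback (conj-transport c) = out^* (A.pullback c)`
  have h1 : B.pullback k (singularCohomology.map ℂ ℂ
      ((AlgPoints.conjugateHomeomorph σ X hσ).symm : C(ComplexPoints (conjugateVariety σ X), ComplexPoints X)) k c) =
      (singularCohomology.map ℂ ℂ outC k).hom (A.pullback k c) := by
    change ((singularCohomology.map ℂ ℂ _ k ≫ singularCohomology.map ℂ ℂ _ k).hom c) =
      ((singularCohomology.map ℂ ℂ _ k ≫ singularCohomology.map ℂ ℂ outC k).hom c)
    rw [← singularCohomology.map_comp, ← singularCohomology.map_comp]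
    congr 3
    ext m : 1
    change (AlgPoints.conjugateHomeomorph σ X hσ).symm (AlgPoints.toConjugate σ X _) = A.toComplexPoints (Rechart.out L.toHomeomorph A.carrier m)
    rw [AlgPoints.conjugateHomeomorph_symm_apply, AlgPoints.ofConjugate_toConjugate]
  -- Step 2: `B.hodgePQ q p = out^* (A.hodgePQ p q)` (naturality of `A.deRham` along `out` and `hodgePQ_map_out_eq`)
  have h2 : B.hodgePQ k q p = (A.hodgePQ k p q).map (singularCohomology.map ℂ ℂ outC k).hom := by
    change (hodgePQ A.model (Rechart L.toHomeomorph A.carrier) k q p).map (A.deRham (Rechart L.toHomeomorph A.carrier) k).toLinearMap =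
      ((hodgePQ A.model A.carrier k p q).map (A.deRham A.carrier k).toLinearMap).map _
    rw [← hodgePQ_map_out_eq L hL k p q, ← Submodule.map_comp, ← Submodule.map_comp]
    congr 1
    refine LinearMap.ext fun w ↦ ?_
    rw [LinearMap.comp_apply, LinearMap.comp_apply, LinearEquiv.coe_toLinearMap, LinearEquiv.coe_toLinearMap]
    exact A.deRham_isNatural (Rechart L.toHomeomorph A.carrier) A.carrier (Rechart.out L.toHomeomorph A.carrier)
      (Rechart.contMDiff_out_linear (M := A.carrier) L) k w
  rw [h1, h2]
  constructor
  · exact fun h ↦ Submodule.mem_map_of_mem h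
  · rintro ⟨y, hy, hyx⟩
    rwa [← hinj hyx]


/-! ## The conjugate variety of `Y ×_{L,ι} ℂ` is `Y ×_{L,ῑ} ℂ`, compatibly with complex conjugation of points -/

section Agreement

open _root_.AlgebraicGeometry _root_.CategoryTheory.Limits

variable {L : Type} [Field L] (ι : L →+* ℂ) (Y : SchemeOver L)

/-- **`(Y ×_{L,ι} ℂ)^{conj} ≅ Y ×_{L,ῑ} ℂ` carries p04's conjugation of points to Charles–Schnell's `toConjugate`**: for a complex point `P`
of `X = Y ×_{L,ι} ℂ`, the point `conjComplexPoints ι Y P` of `Y ×_{L,ῑ} ℂ`, read in the conjugate variety `X^σ = X ×_{ℂ,σ} ℂ` through the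
transitivity isomorphism `X^σ = (Y ×_ι ℂ) ×_σ ℂ ≅ Y ×_{σ∘ι} ℂ` (`Motives.baseChangeHomObjIsoOfComp`), is the point `toConjugate σ X P =
(Spec σ ≫ P, 𝟙)` (both lie over `Spec σ ≫ P` in `Y` and over `Spec σ` in `Spec ℂ`). [cite: Deligne1982HodgeCycles, §1 (p. 7)] -/
theorem map_iso_inv_conjComplexPoints (P : ComplexPoints ((baseChangeHom ι).obj Y)) :
    AlgPoints.map (Y := conjugateVariety (starRingAut : ℂ ≃+* ℂ) ((baseChangeHom ι).obj Y))
        (baseChangeHomObjIsoOfComp ι (starRingAut : ℂ ≃+* ℂ).toRingHom (conjEmb ι) (conjEmb_eq ι).symm Y).inv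
        (conjComplexPoints ι Y P) =
      AlgPoints.toConjugate (starRingAut : ℂ ≃+* ℂ) ((baseChangeHom ι).obj Y) P := by
  set θ : conjugateVariety (starRingAut : ℂ ≃+* ℂ) ((baseChangeHom ι).obj Y) ≅ (baseChangeHom (conjEmb ι)).obj Y :=
    baseChangeHomObjIsoOfComp ι (starRingAut : ℂ ≃+* ℂ).toRingHom (conjEmb ι) (conjEmb_eq ι).symm Y with hθ
  apply AlgPoints.ext_of_comp_conjFst
  rw [AlgPoints.toSpecHom_toConjugate_comp_conjFst]
  change ((conjComplexPoints ι Y P) ≫ θ.inv).left ≫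
      AlgPoints.conjFst (starRingAut : ℂ ≃+* ℂ) ((baseChangeHom ι).obj Y) = _
  rw [Over.comp_left, Category.assoc]
  have hθ' : θ.inv.left ≫ AlgPoints.conjFst (starRingAut : ℂ ≃+* ℂ) ((baseChangeHom ι).obj Y) ≫ baseChangeHomFst ι Y =
      baseChangeHomFst (conjEmb ι) Y := by
    have h0 : θ.hom.left ≫ baseChangeHomFst (conjEmb ι) Y =
        AlgPoints.conjFst (starRingAut : ℂ ≃+* ℂ) ((baseChangeHom ι).obj Y) ≫ baseChangeHomFst ι Y :=
      baseChangeHomObjIsoOfComp_hom_left_fst ι (starRingAut : ℂ ≃+* ℂ).toRingHom (conjEmb ι) (conjEmb_eq ι).symm Y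
    rw [← h0, ← Over.comp_left_assoc, Iso.inv_hom_id, Over.id_left, Category.id_comp]
  have hsq : AlgPoints.conjFst (starRingAut : ℂ ≃+* ℂ) ((baseChangeHom ι).obj Y) ≫ ((baseChangeHom ι).obj Y).hom =
      (conjugateVariety (starRingAut : ℂ ≃+* ℂ) ((baseChangeHom ι).obj Y)).hom ≫
        Spec.map (CommRingCat.ofHom (starRingAut : ℂ ≃+* ℂ).toRingHom) :=
    pullback.condition
  have w1 : θ.inv.left ≫ AlgPoints.conjFst (starRingAut : ℂ ≃+* ℂ) ((baseChangeHom ι).obj Y) ≫ ((baseChangeHom ι).obj Y).hom =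
      ((baseChangeHom (conjEmb ι)).obj Y).hom ≫ Spec.map (CommRingCat.ofHom (starRingAut : ℂ ≃+* ℂ).toRingHom) := by
    rw [hsq, ← Category.assoc, Over.w θ.inv]
  have w2 : (conjComplexPoints ι Y P).left ≫ ((baseChangeHom (conjEmb ι)).obj Y).hom = 𝟙 _ :=
    ComplexPoints.toSpecHom_comp_hom _
  have w3 : P.toSpecHom ≫ ((baseChangeHom ι).obj Y).hom = 𝟙 _ := ComplexPoints.toSpecHom_comp_hom P
  -- both sides are morphisms `Spec ℂ ⟶ X.left = Y.left ×_{Spec L} Spec ℂ`: compare the two projections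
  refine pullback.hom_ext ?_ ?_
  · -- to `Y`
    change ((conjComplexPoints ι Y P).left ≫ θ.inv.left ≫
        AlgPoints.conjFst (starRingAut : ℂ ≃+* ℂ) ((baseChangeHom ι).obj Y)) ≫ baseChangeHomFst ι Y =
      (Spec.map (CommRingCat.ofHom (starRingAut : ℂ ≃+* ℂ).toRingHom) ≫ P.toSpecHom) ≫ baseChangeHomFst ι Y
    rw [Category.assoc, Category.assoc, hθ', Category.assoc]
    letI := ι.toAlgebra
    have h1 : (conjComplexPoints ι Y P).left ≫ baseChangeHomFst (conjEmb ι) Y =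
        (twist (conjEmb_eq ι) ((AlgPoints.baseChangeEquiv ι Y).symm P)).left :=
      AlgPoints.baseChangeEquiv_apply_left_comp_fst (conjEmb ι) Y _
    rw [h1, twist_left, AlgPoints.baseChangeEquiv_symm_apply_left]
    rfl
  · -- to `Spec ℂ`
    change ((conjComplexPoints ι Y P).left ≫ θ.inv.left ≫
        AlgPoints.conjFst (starRingAut : ℂ ≃+* ℂ) ((baseChangeHom ι).obj Y)) ≫ ((baseChangeHom ι).obj Y).hom =
      (Spec.map (CommRingCat.ofHom (starRingAut : ℂ ≃+* ℂ).toRingHom) ≫ P.toSpecHom) ≫ ((baseChangeHom ι).obj Y).hom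
    rw [Category.assoc, Category.assoc, w1, ← Category.assoc, w2, Category.assoc, w3]
    simp only [Category.comp_id]
    exact Category.id_comp _

/-- Consequence on points: `ofConjugate ∘ (· ≫ θ⁻¹) = conjComplexPoints⁻¹` as maps `(Y ×_ῑ ℂ)(ℂ) → (Y ×_ι ℂ)(ℂ)`.
[cite: Deligne1982HodgeCycles, §1 (p. 7)] -/
theorem ofConjugate_map_iso_inv (Q : ComplexPoints ((baseChangeHom (conjEmb ι)).obj Y)) :
    AlgPoints.ofConjugate (starRingAut : ℂ ≃+* ℂ) ((baseChangeHom ι).obj Y)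
        (AlgPoints.map (Y := conjugateVariety (starRingAut : ℂ ≃+* ℂ) ((baseChangeHom ι).obj Y))
          (baseChangeHomObjIsoOfComp ι (starRingAut : ℂ ≃+* ℂ).toRingHom (conjEmb ι) (conjEmb_eq ι).symm Y).inv Q) =
      (conjComplexPoints ι Y).symm Q := by
  have h := map_iso_inv_conjComplexPoints ι Y ((conjComplexPoints ι Y).symm Q)
  rw [Homeomorph.apply_symm_apply] at h
  rw [h, AlgPoints.ofConjugate_toConjugate]

end Agreement

/-! ## The theorem -/

/-- **HODGE TYPES ARE REVERSED UNDER COMPLEX CONJUGATION OF THE STRUCTURE EMBEDDING — discharge of the named fact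
`ConjEmbedding.isOfHodgeType_conj_iff`** ([Deligne1979Valeurs] 0.2.5: `F_∞ : H_σ(M) ⥲ H_{cσ}(M)` sends `H^{pq}_σ` onto `H^{qp}_{cσ}`;
[Deligne1982HodgeCycles] §1 p. 7).  Proof: a Hodge model `A` of `X = Y ×_ι ℂ` (exists, `HodgeModel_nonempty`) has a CONJUGATE Hodge model
`Ā` of the conjugate variety `X^σ` (`exists_conjugate_hodgeModel`: the conjugate complex manifold, same de Rham comparison, `H^{p,q} ↔ H^{q,p}`),
`X^σ ≅ Y ×_ῑ ℂ` compatibly with the conjugation of points (`ofConjugate_map_iso_inv`), Hodge types are independent of the model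
(`hodgePQ_independent_of_hodgeModel_holds`) and transported along isomorphisms (`IsOfHodgeType.map_of_le`).
[cite: Deligne1979Valeurs, 0.2.5 (p. 315)] [cite: Deligne1982HodgeCycles, §1 (p. 7)] [cite: VoisinHodgeI2002, §6.1.2–6.1.3] -/
theorem isOfHodgeType_conj_iff_holds : isOfHodgeType_conj_iff := by
  intro L _ ι Y n hX hXbar k p q c
  haveI := ι.toAlgebra
  let σ : ℂ ≃+* ℂ := starRingAut
  let X : SchemeOver ℂ := (baseChangeHom ι).obj Y
  let θ : conjugateVariety σ X ≅ (baseChangeHom (conjEmb ι)).obj Y :=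
    baseChangeHomObjIsoOfComp ι σ.toRingHom (conjEmb ι) (conjEmb_eq ι).symm Y
  have hXσ : IsSmoothProjective n (conjugateVariety σ X) := IsSmoothProjective.of_iso θ.symm hXbar
  obtain ⟨A⟩ := HodgeModel_nonempty hX
  obtain ⟨B, hB⟩ := exists_conjugate_hodgeModel A σ continuous_starRingAut (fun _ ↦ rfl)
  obtain ⟨Bbar⟩ := HodgeModel_nonempty hXbar
  -- the two transports of `c`
  set c' : complexBetti ((baseChangeHom (conjEmb ι)).obj Y) k := (complexBettiConj ι Y k).hom c with hc'
  set c'' : singularCohomology ℂ ℂ (ComplexPoints (conjugateVariety σ X)) k :=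
    singularCohomology.map ℂ ℂ ((AlgPoints.conjugateHomeomorph σ X continuous_starRingAut).symm :
      C(ComplexPoints (conjugateVariety σ X), ComplexPoints X)) k c with hc''
  have key1 : singularCohomology.map ℂ ℂ (AlgPoints.mapContinuous (L := ℂ) θ.inv) k c'' = c' := by
    rw [hc'', hc', complexBettiConj, singularCohomology.mapIso_hom]
    change ((singularCohomology.map ℂ ℂ _ k ≫ singularCohomology.map ℂ ℂ _ k).hom c) = _
    rw [← singularCohomology.map_comp]
    congr 3
    ext Q : 1
    exact ofConjugate_map_iso_inv ι Y Q
  have key2 : singularCohomology.map ℂ ℂ (AlgPoints.mapContinuous (L := ℂ) θ.hom) k c' = c'' := by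
    rw [← key1]
    change ((singularCohomology.map ℂ ℂ _ k ≫ singularCohomology.map ℂ ℂ _ k).hom c'') = _
    rw [← singularCohomology.map_comp]
    have e : (AlgPoints.mapContinuous (L := ℂ) θ.inv).comp (AlgPoints.mapContinuous (L := ℂ) θ.hom) =
        ContinuousMap.id _ := by
      ext Q : 1
      change (Q ≫ θ.hom) ≫ θ.inv = Q
      rw [Category.assoc, Iso.hom_inv_id, Category.comp_id]
    rw [e, singularCohomology.map_id]
    rfl
  constructor
  · rintro ⟨A', hA'⟩
    have hA : A.pullback k c ∈ A.hodgePQ k p q := hodgePQ_independent_of_hodgeModel_holds n X hX A' A k p q c hA'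
    have hB'' : IsOfHodgeType n (conjugateVariety σ X) k q p c'' := ⟨B, (hB k p q c).1 hA⟩
    have := hB''.map_of_le hXbar hXσ Bbar θ.inv le_rfl
    rwa [key1] at this
  · intro h
    have h'' : IsOfHodgeType n (conjugateVariety σ X) k q p c'' := by
      have := h.map_of_le hXσ hXbar B θ.hom le_rfl
      rwa [key2] at this
    obtain ⟨B', hB'⟩ := h''
    exact ⟨A, (hB k p q c).2 (hodgePQ_independent_of_hodgeModel_holds n _ hXσ B' B k q p c'' hB')⟩

end Literature.AlgebraicGeometry.HodgeTheory.ConjEmbedding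

end
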